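/-
Copyright (c) 2026 the pub-hodgecm-mathlib formalisation cell (harness21).  Prover seat hodgecm-mathlib-LH4-p12 (g9), req620 Track A «(D-RAM) FOUR-FRAME» squad
((β₂) road (R-36), β₂ WORD #28 (b) ∕ #30 «K6-(c) OFF→GEN JUNCTION», SHELL HALF, part 2 of 2: «AT ODD `d` THE ROW-CELL SHELLS ARE READ ON THE RAY SCALAR» — one-writer split with LH7-p10 (g3), who types the existence half), 2026-09-05.
-/
import Summits.HodgeConjecture.HodgeConjecture.Theorems.F0P3cDyRamRowCellRayScalarOddD   -- (this seat) part 1: `v_rayScalar_eq_of_row_inside`, `v_rayScalar_eq_one_of_row_terminal`; brings ★ `…UpperLineRayLetters`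
import Summits.HodgeConjecture.HodgeConjecture.Theorems.F0P3cDyRamShellOfExactLevel      -- ★ p863487 (LH7-p09 (g2)) FILE 10: `latticeNearTransvShell_iff_exactLevel_of_prod`
import HarnessLib

/-!
# Crux `H413`, line LH4 «(D-RAM) FOUR-FRAME» — the (β₂) road (R-36), K6-(c) «OFF→GEN JUNCTION», SHELL HALF (2∕2): «AT ODD `d` THE ROW-CELL SHELLS ARE READ ON THE RAY SCALAR» —
# on the odd-`d` live row `|lam − jE u₀₀| = |ϖE|^{2b+1}` (`ℓ₀ = 1`) a glued vertex INSIDE the cell range (`|μ − ρμ| ≤ |cc(α − ρα)|·|ϖE|^{b+2}`) is on BOTH shells `(1, M)`, a vertex of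
# the TERMINAL cell (`|μ − ρμ| = |cc(α − ρα)|·|ϖE|^b`) is on NEITHER, and in between the shell token IS the digit condition `|e₀| = |ϖ|`

Cell `hodgecm-mathlib` (D-0151), FLOOR 0, crux item H413 = `stmt-HodgeConjecture-24833`, route of record `HCCMUnconditional`; squad F0∕P3c∕LH4; lane
`--supports stmt-HodgeConjecture-24833 --as helper` (count-neutral; pays NO tier-0 row).  THEOREMS ONLY (no `def`, no instance, no notation, no `sorry`, default heartbeats);
★-only imports; states NO law; (β₂) stays a HYPOTHESIS.  DATUM-FREE: ★ (C1)'s line model `(M, jE, ρ, Θ, α)` (`ρ`, `Θ` commuting isometric involutions, `Fix ρ = jE(E)`, `ρα ≠ α`,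
`|α| ≤ 1`, `|ϖ| = exp(−1)`, `|jE c| ≤ 1 ↔ |c| ≤ 1`), a cell scalar `cc = ρcc` with the CELL letters of ★ p863084 (`Y ∈ 𝒪_cc` Gram-primitive, `|Y| = |ϖE|^b`, `1 ≤ b`, `|cc| ≤ |ϖE|^b`),
and SIZE tokens only — NO residue field, NO `|2|`, ANY `q`; plus ★ `…ShellLineModel`'s glued-vertex frame with `Y := dualGen ρ Θ α cc h x₀`.  `|jE ϖ|` is never evaluated (types
RamK and RamM read the same statements: the odd-`d` live row is `|μ| = |ϖE|^{2b+1}` in both, LH4-p16 (g2) 00:32:42Z «`m = 4b + 2(d%2)`»).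

WHY (β₂ WORD #28 (b) ∕ #30 «K6-(c)»; LH4-p16 (g2) 00:40:23Z «the ROW-cell shell lemma at ODD d — does a ★ exist?»; split 01:20:47Z with LH7-p10 (g3), who types the existence
half).  At even `d` (`ℓ₀ = 0`) ★ p863084 puts every row vertex strictly inside the anti-diagonal on level EXACTLY `0`.  At ODD `d` the shells ask level `1` on the row
`|μ| = |ϖE|^{2b+1}`; by ★ `…UpperLineRayLetters` the level token is the size of the ray scalar (`|e₀|·|cc(α − ρα)| = |κ − ρκ|`, `κ = μ∕Y`), and `κ − ρκ = (B·P − A·Q)(α − ρα)∕(Y·ρY)`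
in ★ p862572's `Fix ρ`-coordinates (`|Q| ∈ (|cc|·|ϖE|, |cc|]` by Gram-primitivity).  Three regimes, decided by `|B| = |μ − ρμ|∕|α − ρα|`:
* INSIDE `|μ − ρμ| ≤ |cc(α − ρα)|·|ϖE|^{b+2}` (lane B: `j + b + 2 ≤ jl`): `|A| = |ϖE|^{2b+1}`, `A·Q` dominates STRICTLY, `|ϖ|² < |e₀| ≤ |ϖ|`, so `|e₀| = |ϖ|`: ON both shells.
* TERMINAL `|μ − ρμ| = |cc(α − ρα)|·|ϖE|^b`, `|cc| < |ϖE|^b` (lane B: `j + b = jl`): `B·P` dominates, `|e₀| = 1`: level EXACTLY `0`, on NEITHER shell.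
* BOUNDARY (lane B: `j + b + 1 = jl`): the two tie, `|e₀| ≤ |ϖ|` varies — the shell token IS the digit condition `|e₀| = |ϖ|` (LH4-p19 (g3)'s `NX`).
THIS FILE (2∕2), per glued vertex (★ `…ShellLineModel`'s frame, `Y := dualGen ρ Θ α cc h x₀`): HEAD-bd `latticeNearTransvShell_one_iff_v_rayScalar_eq` (shell `(1, M) ↔ |e₀| = |ϖ|`, ★ FILE 10's letters), HEAD-in
`latticeNearTransvShell_one_of_row_inside`, HEAD-term `not_latticeInLevel_one_of_row_terminal`.  The FOLDS through ★ p862869's junction are the next file.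
HONEST LABEL.  Count-neutral valuation ∕ order algebra; nothing printed is asserted; no census law is stated; ‹ROW›∕‹ROW-ODD›∕‹CORE-*›∕‹FLIPT› and every (OFF) band letter stay OPEN;
`HC_CM` is proved only modulo the 7 printed citations (2 remaining named inputs: hLiu418 = `stmt-HodgeConjecture-24832`, h413 = `stmt-HodgeConjecture-24833`) until rung 0 closes.
## References
* [Serre1979] J.-P. Serre, *Local Fields*, GTM 67 (1979): Ch. III §3 Prop. 7, Ch. III §6 Prop. 12 (orders of conductor `c`).
* [Jacobowitz1962] R. Jacobowitz, *Hermitian forms over local fields*, Amer. J. Math. 84 (1962): §4 (duals, Gram-primitivity, gluing).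
* [Kottwitz1986BaseChangeUnits] R. E. Kottwitz, *Base change for unit elements of Hecke algebras*, Compositio Math. 60 (1986): §1 pp. 240–241, §3 (congruence levels).
* [Rogawski1990] J. D. Rogawski, *Automorphic Representations of Unitary Groups in Three Variables*, Ann. of Math. Stud. 123 (1990): §4.9 Prop. 4.9.1 (b) p. 55.
-/

set_option autoImplicit false

noncomputable section

namespace Summit.HodgeConjecture.HodgeConjecture.Cruxes.H413.F0P3cDyRamRowCellShellOddD

open scoped Valued WithZero Matrix MatrixGroups
open WithZero
open Literature.NumberTheory.Automorphic Literature.NumberTheory.Automorphic.HermitianLattice Literature.NumberTheory.Automorphic.UnitaryLatticeTree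
open Literature.NumberTheory.Rogawski1990
open Summit.HodgeConjecture.HodgeConjecture.Cruxes.H413.F0P3cDyRamToricCensusDefs
open Summit.HodgeConjecture.HodgeConjecture.Cruxes.H413.F0P3cDyRamFourFrameCensusDefs (LatticeInLevel LatticeNearTransvShell)
open Summit.HodgeConjecture.HodgeConjecture.Cruxes.H413.F0P3cDyRamRowCellOnShell (uniformizer_letters)
open Summit.HodgeConjecture.HodgeConjecture.Cruxes.H413.F0P3cDyRamShellOfExactLevel (latticeNearTransvShell_iff_exactLevel_of_prod)
open Summit.HodgeConjecture.HodgeConjecture.Cruxes.H413.F0P3cDyRamUpperLineRayLetters (latticeInLevel_iff_v_rayScalar_le exactLevel_iff_v_rayScalar_eq)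
open Summit.HodgeConjecture.HodgeConjecture.Cruxes.H413.F0P3cDyRamRowCellRayScalarOddD (v_rayScalar_eq_of_row_inside v_rayScalar_eq_one_of_row_terminal)

variable {E M : Type} [Field E] [Valued E ℤᵐ⁰] [Field M] [Valued M ℤᵐ⁰] {ρ Θ : M →+* M} {α : M}

/-! ## §2 HEADS — the shells of a glued vertex over an odd-row cell member -/

/-- **HEAD-bd — «ON THE ODD ROW THE SHELL TOKEN IS THE DIGIT CONDITION `|e₀| = |ϖ|`».**  ★ `…ShellLineModel`'s glued-vertex frame (`hb hpr hB hg₀ hg₀1 hprg hBΛ hx₀ hΛx hw₀Y`) with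
`Y := dualGen ρ Θ α cc h x₀`, the ray-scalar letters (`Θh = h`, `ρcc = cc`, `cc(α − ρα) ≠ 0`, `he₀`), ★ FILE 10's letters (`1 + k = M`, `|u₀₀ − 1| ≤ |ϖ^k|`, `|μ| ≤ |ϖE|^k`,
the product letter) and the four cell-constant level-`2` letters (`|u₀₀ − 1| ≤ |ϖ²|`, `|lam − 1| ≤ |ϖE|²`, `|lam − ρlam| ≤ |cc(α − ρα)|·|ϖE|²`, `|μ| ≤ |ϖE²·Y|`).  THEN
`LatticeNearTransvShell ϖ 1 M (Γ − 1) L ↔ |e₀| = |ϖ|` — any regime; on the BOUNDARY cell this is the `NX` digit of LH4-p19's three-way socket.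
[cite: Kottwitz1986BaseChangeUnits, §3] [cite: Rogawski1990, §4.9 Prop. 4.9.1 (b) p. 55] [cite: Serre1979, Ch. III §6 Prop. 12] -/
theorem latticeNearTransvShell_one_iff_v_rayScalar_eq
    (hρρ : ∀ x, ρ (ρ x) = x) (hvρ : ∀ x, Valued.v (ρ x) = Valued.v x) (hΘΘ : ∀ x, Θ (Θ x) = x) (hΘρ : ∀ x, Θ (ρ x) = ρ (Θ x))
    (hvΘ : ∀ x, Valued.v (Θ x) = Valued.v x) {ϖ : E} (hϖ : Valued.v ϖ = exp (-1 : ℤ))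
    (jE : E →+* M) (hjv : ∀ c, Valued.v (jE c) ≤ 1 ↔ Valued.v c ≤ 1) (hjfix : ∀ z, ρ z = z ↔ ∃ c, jE c = z)
    (φ : (Fin 2 → E) →+ M) (hφs : ∀ (c : E) (x : Fin 2 → E), φ (c • x) = jE c * φ x) (hφi : Function.Injective φ)
    {γ₂ : GL (Fin 2) E} {lam h : M} (hφγ : ∀ x, φ ((γ₂ : Matrix (Fin 2) (Fin 2) E) *ᵥ x) = lam * φ x) (hΘh : Θ h = h)
    {L : Submodule 𝒪[E] (Fin 3 → E)} {b : ℕ} (hb : ∀ a : E, (Pi.single 1 a : Fin 3 → E) ∈ L ↔ Valued.v a ≤ Valued.v ϖ ^ b)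
    (hpr : ∀ x ∈ L, Valued.v (x 1) * Valued.v ϖ ^ b ≤ 1)
    {B₂ : Submodule 𝒪[E] (Fin 2 → E)} {w₀ : Fin 2 → E} {g₀ : Fin 3 → E}
    (hB : B₂.map ((Matrix.toLin' (!![1, 0; 0, 0; 0, 1] : Matrix (Fin 3) (Fin 2) E)).restrictScalars 𝒪[E]) =
      L ⊓ LinearMap.ker ((LinearMap.proj (1 : Fin 3) : (Fin 3 → E) →ₗ[E] E).restrictScalars 𝒪[E]))
    (hg₀ : g₀ ∈ L) (hg₀1 : Valued.v (g₀ 1) * Valued.v ϖ ^ b = 1) (hprg : g₀ - Pi.single 1 (g₀ 1) = ![w₀ 0, 0, w₀ 1])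
    {Λ : AddSubgroup M} (hBΛ : B₂.toAddSubgroup.map φ = Λ) {cc x₀ : M} (hc : ρ cc = cc) (hcc : cc * (α - ρ α) ≠ 0) (hx₀ : x₀ ≠ 0)
    (hΛx : ∀ x, x ∈ Λ ↔ ∃ z, IsOrd ρ α cc z ∧ x = x₀ * z) (hw₀Y : φ w₀ = (dualGen ρ Θ α cc h x₀)⁻¹ * x₀)
    (hYb : Valued.v (dualGen ρ Θ α cc h x₀) = Valued.v (jE ϖ) ^ b)
    (u : GL (Fin 1) E) (k Ms : ℕ) (hmk : 1 + k = Ms)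
    (huk : Valued.v ((u : Matrix (Fin 1) (Fin 1) E) 0 0 - 1) ≤ Valued.v (ϖ ^ k))
    (hμk : Valued.v (lam - jE ((u : Matrix (Fin 1) (Fin 1) E) 0 0)) ≤ Valued.v (jE ϖ) ^ k)
    (hprod : Valued.v (lam - jE ((u : Matrix (Fin 1) (Fin 1) E) 0 0)) * Valued.v ((lam - jE ((u : Matrix (Fin 1) (Fin 1) E) 0 0)) - ρ (lam - jE ((u : Matrix (Fin 1) (Fin 1) E) 0 0))) ≤
      Valued.v (cc * (α - ρ α)) * Valued.v (dualGen ρ Θ α cc h x₀) * Valued.v (jE ϖ) ^ Ms)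
    (hul : Valued.v ((u : Matrix (Fin 1) (Fin 1) E) 0 0 - 1) ≤ Valued.v (ϖ ^ (1 + 1)))
    (hlam1 : Valued.v (lam - 1) ≤ Valued.v (jE ϖ) ^ (1 + 1))
    (hlamρ : Valued.v (lam - ρ lam) ≤ Valued.v (cc * (α - ρ α)) * Valued.v (jE ϖ) ^ (1 + 1))
    (hμl : Valued.v (lam - jE ((u : Matrix (Fin 1) (Fin 1) E) 0 0)) ≤ Valued.v (jE ϖ ^ (1 + 1) * dualGen ρ Θ α cc h x₀))
    {e₀ : E} (he₀ : jE e₀ = (lam - jE ((u : Matrix (Fin 1) (Fin 1) E) 0 0)) / (cc * (α - ρ α) * Θ (dualGen ρ Θ α cc h x₀)) +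
      ρ ((lam - jE ((u : Matrix (Fin 1) (Fin 1) E) 0 0)) / (cc * (α - ρ α) * Θ (dualGen ρ Θ α cc h x₀)))) :
    LatticeNearTransvShell ϖ 1 Ms ((((endoGL (γ₂, u) : GL (Fin 3) E) : Matrix (Fin 3) (Fin 3) E) - 1)) L ↔ Valued.v e₀ = Valued.v ϖ := by
  obtain ⟨-, -, -, hvjϖ0, -, -, -⟩ := uniformizer_letters jE hjv hϖ
  have hρϖ : ρ (jE ϖ) = jE ϖ := (hjfix _).2 ⟨ϖ, rfl⟩
  have hY0 : dualGen ρ Θ α cc h x₀ ≠ 0 := fun h0 => pow_ne_zero b hvjϖ0 (hYb.symm.trans (by rw [h0, Valuation.map_zero]))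
  rw [latticeNearTransvShell_iff_exactLevel_of_prod hvρ hϖ jE hjv hjfix φ hφs hφi hφγ hb hpr hB hg₀ hg₀1 hprg hBΛ hx₀ hΛx hw₀Y hYb u 1 k Ms hmk huk hμk hprod,
    exactLevel_iff_v_rayScalar_eq hρρ hvρ hΘΘ hΘρ hvΘ hϖ jE hjv hρϖ φ hφs hφi hφγ hΘh hb hpr hB hg₀ hg₀1 hprg hBΛ hc hcc hx₀ hY0 hΛx hw₀Y u 1 hul hlam1 hlamρ hμl he₀,
    pow_one]

/-- **HEAD-in — «INSIDE THE ODD ROW EVERY GLUED VERTEX IS ON BOTH SHELLS `(1, M)`».**  Frame of HEAD-bd, the CELL letters of ★ p863084 (`Y ∈ 𝒪_cc` Gram-primitive, `1 ≤ b`,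
`|cc| ≤ |ϖE|^b`), ROW `|μ| = |ϖE|^{2b+1}`, INSIDE `|μ − ρμ| ≤ |cc(α − ρα)|·|ϖE|^{b+2}`, ★ FILE 10's letters at `M`, and the three cell-constant level-`2` letters (`|u₀₀ − 1| ≤ |ϖ²|`,
`|lam − 1| ≤ |ϖE|²`, `|lam − ρlam| ≤ |cc(α − ρα)|·|ϖE|²` — fence ∕ `jl ≥ j + 2`).  THEN `LatticeNearTransvShell ϖ 1 M (Γ − 1) L` — the odd-`d` twin of ★ p863084's
`latticeNearTransvShell_zero_of_row`; the shell conjunct DROPS from both literals of such a cell. [cite: Kottwitz1986BaseChangeUnits, §3] [cite: Rogawski1990, §4.9 Prop. 4.9.1 (b) p. 55]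
[cite: Jacobowitz1962, §4] -/
theorem latticeNearTransvShell_one_of_row_inside
    (hρρ : ∀ x, ρ (ρ x) = x) (hvρ : ∀ x, Valued.v (ρ x) = Valued.v x) (hΘΘ : ∀ x, Θ (Θ x) = x) (hΘρ : ∀ x, Θ (ρ x) = ρ (Θ x))
    (hvΘ : ∀ x, Valued.v (Θ x) = Valued.v x) (hα : ρ α ≠ α) (hα1 : Valued.v α ≤ 1) {ϖ : E} (hϖ : Valued.v ϖ = exp (-1 : ℤ))
    (jE : E →+* M) (hjv : ∀ c, Valued.v (jE c) ≤ 1 ↔ Valued.v c ≤ 1) (hjfix : ∀ z, ρ z = z ↔ ∃ c, jE c = z)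
    (φ : (Fin 2 → E) →+ M) (hφs : ∀ (c : E) (x : Fin 2 → E), φ (c • x) = jE c * φ x) (hφi : Function.Injective φ)
    {γ₂ : GL (Fin 2) E} {lam h : M} (hφγ : ∀ x, φ ((γ₂ : Matrix (Fin 2) (Fin 2) E) *ᵥ x) = lam * φ x) (hΘh : Θ h = h)
    {L : Submodule 𝒪[E] (Fin 3 → E)} {b : ℕ} (hb : ∀ a : E, (Pi.single 1 a : Fin 3 → E) ∈ L ↔ Valued.v a ≤ Valued.v ϖ ^ b)
    (hpr : ∀ x ∈ L, Valued.v (x 1) * Valued.v ϖ ^ b ≤ 1)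
    {B₂ : Submodule 𝒪[E] (Fin 2 → E)} {w₀ : Fin 2 → E} {g₀ : Fin 3 → E}
    (hB : B₂.map ((Matrix.toLin' (!![1, 0; 0, 0; 0, 1] : Matrix (Fin 3) (Fin 2) E)).restrictScalars 𝒪[E]) =
      L ⊓ LinearMap.ker ((LinearMap.proj (1 : Fin 3) : (Fin 3 → E) →ₗ[E] E).restrictScalars 𝒪[E]))
    (hg₀ : g₀ ∈ L) (hg₀1 : Valued.v (g₀ 1) * Valued.v ϖ ^ b = 1) (hprg : g₀ - Pi.single 1 (g₀ 1) = ![w₀ 0, 0, w₀ 1])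
    {Λ : AddSubgroup M} (hBΛ : B₂.toAddSubgroup.map φ = Λ) {cc x₀ : M} (hc : ρ cc = cc) (hcc : cc * (α - ρ α) ≠ 0) (hx₀ : x₀ ≠ 0)
    (hΛx : ∀ x, x ∈ Λ ↔ ∃ z, IsOrd ρ α cc z ∧ x = x₀ * z) (hw₀Y : φ w₀ = (dualGen ρ Θ α cc h x₀)⁻¹ * x₀)
    (hYO : IsOrd ρ α cc (dualGen ρ Θ α cc h x₀)) (hYprim : ¬ IsOrd ρ α cc (dualGen ρ Θ α cc h x₀ / jE ϖ)) (hb1 : 1 ≤ b)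
    (hYb : Valued.v (dualGen ρ Θ α cc h x₀) = Valued.v (jE ϖ) ^ b) (hcb : Valued.v cc ≤ Valued.v (jE ϖ) ^ b)
    (u : GL (Fin 1) E) (hμ : Valued.v (lam - jE ((u : Matrix (Fin 1) (Fin 1) E) 0 0)) = Valued.v (jE ϖ) ^ (2 * b + 1))
    (hanti : Valued.v ((lam - jE ((u : Matrix (Fin 1) (Fin 1) E) 0 0)) - ρ (lam - jE ((u : Matrix (Fin 1) (Fin 1) E) 0 0))) ≤
      Valued.v (cc * (α - ρ α)) * Valued.v (jE ϖ) ^ (b + 2))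
    (k Ms : ℕ) (hmk : 1 + k = Ms)
    (huk : Valued.v ((u : Matrix (Fin 1) (Fin 1) E) 0 0 - 1) ≤ Valued.v (ϖ ^ k))
    (hμk : Valued.v (lam - jE ((u : Matrix (Fin 1) (Fin 1) E) 0 0)) ≤ Valued.v (jE ϖ) ^ k)
    (hprod : Valued.v (lam - jE ((u : Matrix (Fin 1) (Fin 1) E) 0 0)) * Valued.v ((lam - jE ((u : Matrix (Fin 1) (Fin 1) E) 0 0)) - ρ (lam - jE ((u : Matrix (Fin 1) (Fin 1) E) 0 0))) ≤
      Valued.v (cc * (α - ρ α)) * Valued.v (dualGen ρ Θ α cc h x₀) * Valued.v (jE ϖ) ^ Ms)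
    (hul : Valued.v ((u : Matrix (Fin 1) (Fin 1) E) 0 0 - 1) ≤ Valued.v (ϖ ^ (1 + 1)))
    (hlam1 : Valued.v (lam - 1) ≤ Valued.v (jE ϖ) ^ (1 + 1))
    (hlamρ : Valued.v (lam - ρ lam) ≤ Valued.v (cc * (α - ρ α)) * Valued.v (jE ϖ) ^ (1 + 1)) :
    LatticeNearTransvShell ϖ 1 Ms ((((endoGL (γ₂, u) : GL (Fin 3) E) : Matrix (Fin 3) (Fin 3) E) - 1)) L := by
  obtain ⟨-, -, -, -, -, -, hjϖle⟩ := uniformizer_letters jE hjv hϖ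
  have hρϖ : ρ (jE ϖ) = jE ϖ := (hjfix _).2 ⟨ϖ, rfl⟩
  -- the ray scalar is `ρ`-fixed, hence in `E`
  have hfix : ρ ((lam - jE ((u : Matrix (Fin 1) (Fin 1) E) 0 0)) / (cc * (α - ρ α) * Θ (dualGen ρ Θ α cc h x₀)) +
      ρ ((lam - jE ((u : Matrix (Fin 1) (Fin 1) E) 0 0)) / (cc * (α - ρ α) * Θ (dualGen ρ Θ α cc h x₀)))) =
      (lam - jE ((u : Matrix (Fin 1) (Fin 1) E) 0 0)) / (cc * (α - ρ α) * Θ (dualGen ρ Θ α cc h x₀)) +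
      ρ ((lam - jE ((u : Matrix (Fin 1) (Fin 1) E) 0 0)) / (cc * (α - ρ α) * Θ (dualGen ρ Θ α cc h x₀))) := by
    rw [map_add, hρρ, add_comm]
  obtain ⟨e₀, he₀⟩ := (hjfix _).1 hfix
  -- `|μ| ≤ |ϖE²·Y|` on the row (`2b + 1 ≥ b + 2`)
  have hμl : Valued.v (lam - jE ((u : Matrix (Fin 1) (Fin 1) E) 0 0)) ≤ Valued.v (jE ϖ ^ (1 + 1) * dualGen ρ Θ α cc h x₀) := by
    rw [hμ, Valuation.map_mul, Valuation.map_pow, hYb, ← pow_add]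
    exact pow_le_pow_right_of_le_one' hjϖle (by omega)
  exact (latticeNearTransvShell_one_iff_v_rayScalar_eq hρρ hvρ hΘΘ hΘρ hvΘ hϖ jE hjv hjfix φ hφs hφi hφγ hΘh hb hpr hB hg₀ hg₀1 hprg hBΛ hc hcc hx₀ hΛx hw₀Y hYb u k Ms hmk
    huk hμk hprod hul hlam1 hlamρ hμl he₀).2
    (v_rayScalar_eq_of_row_inside hρρ hvρ hΘΘ hΘρ hvΘ hα hα1 jE hjv hϖ hρϖ hΘh hc hcc hYO hYprim hb1 hYb hcb hμ hanti he₀)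

/-- **HEAD-term — «ON THE TERMINAL CELL OF THE ODD ROW NO GLUED VERTEX REACHES LEVEL `1`»** (hence no shell `(1, M)` for any `M`).  Frame of HEAD-bd; CELL `cc ≠ 0`, `Y ∈ 𝒪_cc`,
`|cc| < |ϖE|^b`; ROW `|μ| ≤ |ϖE|^{2b+1}`, TERMINAL `|μ − ρμ| = |cc(α − ρα)|·|ϖE|^b`; the three cell-constant level-`1` letters and `|μ| ≤ |ϖE·Y|`.  THEN `¬ LatticeInLevel ϖ 1 (Γ − 1) L`
(`|e₀| = 1 > |ϖ|`) — both literal sets of the terminal cell are EMPTY. [cite: Kottwitz1986BaseChangeUnits, §3] [cite: Serre1979, Ch. III §6 Prop. 12] [cite: Jacobowitz1962, §4] -/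
theorem not_latticeInLevel_one_of_row_terminal
    (hρρ : ∀ x, ρ (ρ x) = x) (hvρ : ∀ x, Valued.v (ρ x) = Valued.v x) (hΘΘ : ∀ x, Θ (Θ x) = x) (hΘρ : ∀ x, Θ (ρ x) = ρ (Θ x))
    (hvΘ : ∀ x, Valued.v (Θ x) = Valued.v x) (hα : ρ α ≠ α) (hα1 : Valued.v α ≤ 1) {ϖ : E} (hϖ : Valued.v ϖ = exp (-1 : ℤ))
    (jE : E →+* M) (hjv : ∀ c, Valued.v (jE c) ≤ 1 ↔ Valued.v c ≤ 1) (hjfix : ∀ z, ρ z = z ↔ ∃ c, jE c = z)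
    (φ : (Fin 2 → E) →+ M) (hφs : ∀ (c : E) (x : Fin 2 → E), φ (c • x) = jE c * φ x) (hφi : Function.Injective φ)
    {γ₂ : GL (Fin 2) E} {lam h : M} (hφγ : ∀ x, φ ((γ₂ : Matrix (Fin 2) (Fin 2) E) *ᵥ x) = lam * φ x) (hΘh : Θ h = h)
    {L : Submodule 𝒪[E] (Fin 3 → E)} {b : ℕ} (hb : ∀ a : E, (Pi.single 1 a : Fin 3 → E) ∈ L ↔ Valued.v a ≤ Valued.v ϖ ^ b)
    (hpr : ∀ x ∈ L, Valued.v (x 1) * Valued.v ϖ ^ b ≤ 1)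
    {B₂ : Submodule 𝒪[E] (Fin 2 → E)} {w₀ : Fin 2 → E} {g₀ : Fin 3 → E}
    (hB : B₂.map ((Matrix.toLin' (!![1, 0; 0, 0; 0, 1] : Matrix (Fin 3) (Fin 2) E)).restrictScalars 𝒪[E]) =
      L ⊓ LinearMap.ker ((LinearMap.proj (1 : Fin 3) : (Fin 3 → E) →ₗ[E] E).restrictScalars 𝒪[E]))
    (hg₀ : g₀ ∈ L) (hg₀1 : Valued.v (g₀ 1) * Valued.v ϖ ^ b = 1) (hprg : g₀ - Pi.single 1 (g₀ 1) = ![w₀ 0, 0, w₀ 1])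
    {Λ : AddSubgroup M} (hBΛ : B₂.toAddSubgroup.map φ = Λ) {cc x₀ : M} (hc : ρ cc = cc) (hc0 : cc ≠ 0) (hcc : cc * (α - ρ α) ≠ 0) (hx₀ : x₀ ≠ 0)
    (hΛx : ∀ x, x ∈ Λ ↔ ∃ z, IsOrd ρ α cc z ∧ x = x₀ * z) (hw₀Y : φ w₀ = (dualGen ρ Θ α cc h x₀)⁻¹ * x₀)
    (hYO : IsOrd ρ α cc (dualGen ρ Θ α cc h x₀)) (hYb : Valued.v (dualGen ρ Θ α cc h x₀) = Valued.v (jE ϖ) ^ b) (hcb : Valued.v cc < Valued.v (jE ϖ) ^ b)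
    (u : GL (Fin 1) E) (hμ : Valued.v (lam - jE ((u : Matrix (Fin 1) (Fin 1) E) 0 0)) ≤ Valued.v (jE ϖ) ^ (2 * b + 1))
    (hanti : Valued.v ((lam - jE ((u : Matrix (Fin 1) (Fin 1) E) 0 0)) - ρ (lam - jE ((u : Matrix (Fin 1) (Fin 1) E) 0 0))) =
      Valued.v (cc * (α - ρ α)) * Valued.v (jE ϖ) ^ b)
    (hul : Valued.v ((u : Matrix (Fin 1) (Fin 1) E) 0 0 - 1) ≤ Valued.v (ϖ ^ 1))
    (hlam1 : Valued.v (lam - 1) ≤ Valued.v (jE ϖ) ^ 1)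
    (hlamρ : Valued.v (lam - ρ lam) ≤ Valued.v (cc * (α - ρ α)) * Valued.v (jE ϖ) ^ 1)
    (hμl : Valued.v (lam - jE ((u : Matrix (Fin 1) (Fin 1) E) 0 0)) ≤ Valued.v (jE ϖ ^ 1 * dualGen ρ Θ α cc h x₀)) :
    ¬ LatticeInLevel ϖ 1 ((((endoGL (γ₂, u) : GL (Fin 3) E) : Matrix (Fin 3) (Fin 3) E) - 1)) L := by
  obtain ⟨-, hϖlt, -, hvjϖ0, -, -, -⟩ := uniformizer_letters jE hjv hϖ
  have hρϖ : ρ (jE ϖ) = jE ϖ := (hjfix _).2 ⟨ϖ, rfl⟩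
  have hY0 : dualGen ρ Θ α cc h x₀ ≠ 0 := fun h0 => pow_ne_zero b hvjϖ0 (hYb.symm.trans (by rw [h0, Valuation.map_zero]))
  have hfix : ρ ((lam - jE ((u : Matrix (Fin 1) (Fin 1) E) 0 0)) / (cc * (α - ρ α) * Θ (dualGen ρ Θ α cc h x₀)) +
      ρ ((lam - jE ((u : Matrix (Fin 1) (Fin 1) E) 0 0)) / (cc * (α - ρ α) * Θ (dualGen ρ Θ α cc h x₀)))) =
      (lam - jE ((u : Matrix (Fin 1) (Fin 1) E) 0 0)) / (cc * (α - ρ α) * Θ (dualGen ρ Θ α cc h x₀)) +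
      ρ ((lam - jE ((u : Matrix (Fin 1) (Fin 1) E) 0 0)) / (cc * (α - ρ α) * Θ (dualGen ρ Θ α cc h x₀))) := by
    rw [map_add, hρρ, add_comm]
  obtain ⟨e₀, he₀⟩ := (hjfix _).1 hfix
  intro hlev
  have hle := (latticeInLevel_iff_v_rayScalar_le hρρ hvρ hΘΘ hΘρ hvΘ hϖ jE hjv hρϖ φ hφs hφi hφγ hΘh hb hpr hB hg₀ hg₀1 hprg hBΛ hc hcc hx₀ hY0 hΛx hw₀Y u 1
    hul hlam1 hlamρ hμl he₀).1 hlev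
  rw [v_rayScalar_eq_one_of_row_terminal hρρ hvρ hΘΘ hΘρ hvΘ hα hα1 jE hjv hϖ hΘh hc hc0 hcc hYO hYb hcb hμ hanti he₀, pow_one] at hle
  exact absurd (lt_of_lt_of_le hϖlt hle) (lt_irrefl _)

end Summit.HodgeConjecture.HodgeConjecture.Cruxes.H413.F0P3cDyRamRowCellShellOddD

end
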